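import Summits.ResolutionOfSingularities.ResolutionOfSingularities.Theorems.FrobeniusClosingSteerDegreePTransfer
import Summits.ResolutionOfSingularities.ResolutionOfSingularities.Theorems.FrobeniusClosingSteerSwitchingSetup
import Mathlib.RingTheory.Derivation.Basic
import Mathlib.RingTheory.PowerBasis
import Mathlib.FieldTheory.IntermediateField.Algebraic
import HarnessLib

/-!
# Crux `Steer` (stmt-ResolutionOfSingularities-16345), line `switching_dichotomy`: CONSTANTS OF THE
# CONTENT FRAME ARE `p`-TH POWERS (`B = S ∩ K^p`; E1 sub-stub L3½ `constantsEqPthPowers` of the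
# registered stub `stub_logFinalExitM`, skeleton r19)

OURS (campaign `res-hironaka`, rung L ★L-G4, slot W4.1, chain W4.1; unit `res-L0-w41-stub-1` g3, delegated
by the owner of the `LogFinalExitM` sub-stub list, res-L0-w41-stub-9 = res-D-pv-014, 2026-08-27; helper for
line `switching_dichotomy` of crux `Steer`, holder res-L0-w41-lead-1; replaces the role of no printed item;
NOT a statement of the manuscript under review [claim: Hironaka2017, status: under-review]; AI-produced,
which is weaker than expert review). Theses-free and definition-free; pure commutative algebra / field
theory over Mathlib and the chain's landed `DegreePTransfer` (p497399).

**Setting (the E1 half of idea-2's `LogFinalExitM`, PLAN-LogFinalExitM §1 L3–L4).** `k ⊆ K` fields of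
characteristic `p`, `A₀ ⊆ K` a `k`-subalgebra and `t ∈ K` with `t ^ p ∈ A₀`, `Frac (A₀[t]) = K`
(the radicand datum of the crux); `S ⊆ K` a subring with `A₀ ⊆ S ⊆ Frac A₀` (in the assembly: the
local ring `(A₁)_{𝔪_O ∩ A₁}` of a model); `D₁, …, D_r` derivations of `S` killing `f := t ^ p` (the
commuting `p`-nilpotent CONTENT FRAME of `ker (df / h)`, `ContentFrame.exists_frame`, p499709) and
`B ⊆ S` their joint kernel («the constants»). This file proves `B = S ∩ K^p`:

* `mem_of_pow_eq` (elementary half) — an element of `S` that is a `p`-th power `c ^ p`, `c ∈ K`, is a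
  constant: `c = a / b` over `A₀[t]`, the Frobenius of `A₀[t]` lands in `B`
  (`pow_mem_map_of_mem_adjoin`: `t ^ p ∈ B`, `s ^ p ∈ B`), and `b ^ p · D x = D (a ^ p) − x · D (b ^ p) = 0`
  in the domain `S`;
* `exists_pow_eq_of_mem` (the content, by a DEGREE COUNT inside `K`) — every constant is a `p`-th power
  in `K`, GIVEN (i) a `B`-linearly independent family in `S` with `p ^ r` members (the `p`-monomials
  `y ^ e` of a dual family — the iterated slice decomposition of res-L0-w41-stub-6, only its linear
  independence is consumed), (ii) the `p`-degree `[K : K^p] = p ^ (r + 1)` (Matsumura Thm. 26.5: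
  `Literature.FieldTheory.Separability.finrank_frobenius_eq_pow_of_trdeg_eq`, p497687, with
  `r + 1 = dim S = tr.deg_k K`), (iii) some derivation of `S` NOT killing `t ^ p` (the exchange witness
  of the frame; it gives `t ∉ Frac A₀`, `not_mem_adjoin_of_apply_ne_zero`). Count: `K^p ≤ L := Frac B`
  (`frobenius_fieldRange_le_closure`), `[K : L] ≥ p · p ^ r` by the `L`-linearly independent family
  `t ^ j · v i` (`linearIndependent_of_fractions`: clearing denominators; `linearIndependent_pow_mul`:
  the powers `t ^ j`, `j < p = [K : Frac A₀]` (`DegreePTransfer.finrank_fracField_eq_one_or_eq_prime`),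
  are independent over `Frac A₀ ⊇ L`), and the tower `[K : K^p] = [L : K^p] · [K : L]` forces
  `[L : K^p] = 1`, i.e. `B ⊆ L = K^p`;
* `mem_iff` — the packaged equivalence `x ∈ B ↔ ∃ c : K, c ^ p = x`, the hypothesis `hB` of the
  sandwich model (sub-stub L4, res-L0-w41-stub-3) for `B.map S.subtype`.

Sources: folklore; the `p`-degree count is H. Matsumura, *Commutative Ring Theory* (1987), §26,
Thm. 26.5 (a separating transcendence basis is a `p`-basis). [cite: Matsumura1987, Thm. 26.5] [folklore]
-/

noncomputable section

-- `Summit.<S>.<S>.…` duplicates the summit name by design (single-problem summit).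
set_option linter.dupNamespace false

namespace Summit.ResolutionOfSingularities.ResolutionOfSingularities.Theorems.SwitchingDichotomy

namespace ConstantsPthPowers

open Polynomial IntermediateField

variable {k K : Type} [Field k] [Field K] [Algebra k K]

/-! ## `p`-th powers are constants -/

/-- In characteristic `p`, every derivation kills `p`-th powers. [folklore] -/
theorem apply_pow_char_eq_zero (p : ℕ) [CharP K p] (S : Subring K) (D : Derivation ℤ S S) (s : S) :
    D (s ^ p) = 0 := by
  haveI : CharP S p := S.subtype.charP Subtype.val_injective p
  rw [D.leibniz_pow, nsmul_eq_mul, CharP.cast_eq_zero S p, zero_mul]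

/-- **The Frobenius of `A₀[t]` lands in the constants.** For a subring `S ⊆ K` containing `A₀` and
`t ^ p`, derivations `D i` of `S` killing `t ^ p`, and `B` the joint kernel: `a ^ p ∈ B` (as an element
of `K`) for every `a ∈ A₀[t]`. [folklore] -/
theorem pow_mem_map_of_mem_adjoin (p : ℕ) [Fact p.Prime] [CharP K p] (A₀ : Subalgebra k K) (t : K)
    (S : Subring K) (hA₀S : A₀.toSubring ≤ S) (htp : t ^ p ∈ S) {r : ℕ}
    (D : Fin r → Derivation ℤ S S) (hDf : ∀ i, D i ⟨t ^ p, htp⟩ = 0) (B : Subring S)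
    (hB : ∀ c, c ∈ B ↔ ∀ i, D i c = 0) {a : K}
    (ha : a ∈ Algebra.adjoin k (insert t (A₀ : Set K))) : a ^ p ∈ B.map S.subtype := by
  have hpow : ∀ s : S, ((s : K) ^ p) ∈ B.map S.subtype := fun s =>
    ⟨s ^ p, (hB _).mpr fun i => apply_pow_char_eq_zero p S (D i) s, by simp⟩
  refine Algebra.adjoin_induction (p := fun a _ => a ^ p ∈ B.map S.subtype) ?_ ?_ ?_ ?_ ha
  · rintro x (rfl | hx)
    · exact ⟨⟨x ^ p, htp⟩, (hB _).mpr hDf, rfl⟩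
    · exact hpow ⟨x, hA₀S hx⟩
  · intro c
    exact hpow ⟨algebraMap k K c, hA₀S (A₀.algebraMap_mem c)⟩
  · intro x y _ _ hx hy
    rw [← frobenius_def, map_add, frobenius_def, frobenius_def]
    exact Subring.add_mem _ hx hy
  · intro x y _ _ hx hy
    rw [mul_pow]
    exact Subring.mul_mem _ hx hy

/-- **`p`-th powers in `S` are constants** (the elementary half of `B = S ∩ K^p`): in the crux frame
`Frac (A₀[t]) = K`, an element of `S ⊇ A₀ ∪ {t ^ p}` that is a `p`-th power in `K` is killed by every
derivation of `S` killing `t ^ p`. Proof: `x = (a/b)^p` with `a, b ∈ A₀[t]`, `a ^ p, b ^ p ∈ B`, and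
`b ^ p · D x = D (a ^ p) − x · D (b ^ p) = 0` in the domain `S`. [folklore] -/
theorem mem_of_pow_eq (p : ℕ) [Fact p.Prime] [CharP K p] (A₀ : Subalgebra k K) (t : K)
    (hfr : IsFractionRing (Algebra.adjoin k (insert t (A₀ : Set K))) K)
    (S : Subring K) (hA₀S : A₀.toSubring ≤ S) (htp : t ^ p ∈ S) {r : ℕ}
    (D : Fin r → Derivation ℤ S S) (hDf : ∀ i, D i ⟨t ^ p, htp⟩ = 0) (B : Subring S)
    (hB : ∀ c, c ∈ B ↔ ∀ i, D i c = 0) (x : S) (c : K) (hc : c ^ p = x) : x ∈ B := by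
  haveI := hfr
  obtain ⟨a, b, -, rfl⟩ :=
    IsFractionRing.div_surjective (A := Algebra.adjoin k (insert t (A₀ : Set K))) c
  change ((a : K) / (b : K)) ^ p = (x : K) at hc
  obtain ⟨α, hα, hαa⟩ := pow_mem_map_of_mem_adjoin p A₀ t S hA₀S htp D hDf B hB a.2
  obtain ⟨β, hβ, hβb⟩ := pow_mem_map_of_mem_adjoin p A₀ t S hA₀S htp D hDf B hB b.2
  simp only [Subring.coe_subtype] at hαa hβb
  rw [div_pow] at hc
  by_cases hβ0 : β = 0
  · -- then `b = 0`, `c = 0`, `x = 0`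
    have hb0 : ((b : K)) ^ p = 0 := by rw [← hβb, hβ0]; rfl
    have hx0 : (x : K) = 0 := by rw [← hc, hb0, div_zero]
    rw [show x = 0 from Subtype.ext hx0]
    exact B.zero_mem
  · have hxβ : x * β = α := by
      apply Subtype.ext
      have hβ0' : (β : K) ≠ 0 := fun h => hβ0 (Subtype.ext h)
      simp only [Subring.coe_mul]
      rw [hβb, hαa, ← hc, div_mul_cancel₀ _ (hβb ▸ hβ0')]
    refine (hB x).mpr fun i => ?_
    have h1 : D i (x * β) = 0 := by rw [hxβ]; exact (hB α).mp hα i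
    rw [(D i).leibniz, (hB β).mp hβ i, smul_zero, zero_add, smul_eq_mul] at h1
    exact (mul_eq_zero.mp h1).resolve_left hβ0

/-! ## Constants are `p`-th powers (the degree count) -/

/-- **`K^p ⊆ Frac B`**: in the crux frame `Frac (A₀[t]) = K`, every `p`-th power `w ^ p` (`w ∈ K`) is
a quotient of two constants (`w = a / b` over `A₀[t]`, and `a ^ p, b ^ p ∈ B`). [folklore] -/
theorem frobenius_fieldRange_le_closure (p : ℕ) [Fact p.Prime] [CharP K p] (A₀ : Subalgebra k K)
    (t : K) (hfr : IsFractionRing (Algebra.adjoin k (insert t (A₀ : Set K))) K)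
    (S : Subring K) (hA₀S : A₀.toSubring ≤ S) (htp : t ^ p ∈ S) {r : ℕ}
    (D : Fin r → Derivation ℤ S S) (hDf : ∀ i, D i ⟨t ^ p, htp⟩ = 0) (B : Subring S)
    (hB : ∀ c, c ∈ B ↔ ∀ i, D i c = 0) :
    (frobenius K p).fieldRange ≤ Subfield.closure ((B.map S.subtype : Subring K) : Set K) := by
  haveI := hfr
  intro z hz
  obtain ⟨w, rfl⟩ := RingHom.mem_fieldRange.mp hz
  obtain ⟨a, b, -, rfl⟩ :=
    IsFractionRing.div_surjective (A := Algebra.adjoin k (insert t (A₀ : Set K))) w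
  rw [frobenius_def, div_pow]
  exact div_mem (Subfield.subset_closure (pow_mem_map_of_mem_adjoin p A₀ t S hA₀S htp D hDf B hB a.2))
    (Subfield.subset_closure (pow_mem_map_of_mem_adjoin p A₀ t S hA₀S htp D hDf B hB b.2))

/-- **Clearing denominators**: a family in `S` that is linearly independent over the subring `B ⊆ S`
stays linearly independent (inside `K`) over any intermediate field whose elements are quotients of
elements of `B`. [folklore] -/
theorem linearIndependent_of_fractions {E : Subfield K} (L : IntermediateField E K) (S : Subring K)
    (B : Subring S)
    (hL : ∀ c : K, c ∈ L → ∃ a ∈ B.map S.subtype, ∃ b ∈ B.map S.subtype, b ≠ 0 ∧ c = a / b)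
    {ι : Type} [Fintype ι] (v : ι → S) (hv : LinearIndependent B v) :
    LinearIndependent L (fun i => (v i : K)) := by
  classical
  rw [Fintype.linearIndependent_iff]
  intro g hg i₀
  choose a ha b hb hb0 hab using fun i => hL (g i) (g i).2
  -- a common denominator `d`, and the numerators `β i ∈ B`
  have hd0 : (∏ i, b i) ≠ 0 := Finset.prod_ne_zero_iff.mpr fun i _ => hb0 i
  have hn : ∀ i, ∃ β : S, β ∈ B ∧ (β : K) = a i * ∏ j ∈ Finset.univ.erase i, b j := by
    intro i
    obtain ⟨β, hβ, hβe⟩ : a i * ∏ j ∈ Finset.univ.erase i, b j ∈ B.map S.subtype :=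
      Subring.mul_mem _ (ha i) (Subring.prod_mem _ fun j _ => hb j)
    exact ⟨β, hβ, hβe⟩
  choose β hβB hβe using hn
  have hdg : ∀ i, (∏ j, b j) * (g i : K) = (β i : K) := by
    intro i
    rw [hβe, hab i, ← Finset.mul_prod_erase Finset.univ b (Finset.mem_univ i)]
    have hbi := hb0 i
    field_simp
  -- the relation, multiplied by `d`, is a relation over `B` in `S`
  have hrelK : ((∑ i, β i * v i : S) : K) = 0 := by
    push_cast
    simp_rw [← hdg, mul_assoc, ← Finset.mul_sum]
    have hg' : ∑ i, (g i : K) * (v i : K) = 0 := by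
      simpa only [IntermediateField.smul_def, smul_eq_mul] using hg
    rw [hg', mul_zero]
  have hrel : ∑ i, (⟨β i, hβB i⟩ : B) • v i = 0 := by
    have h : (∑ i, β i * v i : S) = 0 := Subtype.ext hrelK
    simpa only [Subring.smul_def, smul_eq_mul] using h
  have hβ0 : β i₀ = 0 :=
    congrArg Subtype.val (Fintype.linearIndependent_iff.mp hv (fun i => ⟨β i, hβB i⟩) hrel i₀)
  -- hence `d * g i₀ = 0`
  have h := hdg i₀
  rw [hβ0, ZeroMemClass.coe_zero, mul_eq_zero] at h
  exact Subtype.ext (h.resolve_left hd0)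

/-- **Tower by hand**: if `u : ι → F` is linearly independent over an intermediate field `L ⊆ F` and the
powers `t ^ j`, `j < p = deg_F t`, are linearly independent over `F`, then the products `t ^ j · u i` are
linearly independent over `L`. [folklore] -/
theorem linearIndependent_pow_mul {E : Subfield K} (L : IntermediateField E K)
    (F : IntermediateField k K) (hLF : ∀ c : K, c ∈ L → c ∈ F) (t : K) {p : ℕ}
    (hdeg : (minpoly F t).natDegree = p) {ι : Type} [Fintype ι] (u : ι → K) (huF : ∀ i, u i ∈ F)
    (hu : LinearIndependent L u) :
    LinearIndependent L (fun ji : Fin p × ι => t ^ (ji.1 : ℕ) * u ji.2) := by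
  classical
  subst hdeg
  rw [Fintype.linearIndependent_iff]
  intro g hg
  -- group the relation by powers of `t`; the coefficients lie in `F`
  have hwF : ∀ j : Fin (minpoly F t).natDegree, ∑ i, (g (j, i) : K) * u i ∈ F := fun j =>
    sum_mem fun i _ => mul_mem (hLF _ (g (j, i)).2) (huF i)
  have hsum : ∑ j : Fin (minpoly F t).natDegree,
      (⟨∑ i, (g (j, i) : K) * u i, hwF j⟩ : F) • t ^ (j : ℕ) = 0 := by
    rw [← hg, Fintype.sum_prod_type]
    refine Finset.sum_congr rfl fun j _ => ?_
    rw [IntermediateField.smul_def, smul_eq_mul, Finset.sum_mul]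
    refine Finset.sum_congr rfl fun i _ => ?_
    rw [IntermediateField.smul_def, smul_eq_mul]
    ring
  have hw0 := Fintype.linearIndependent_iff.mp (linearIndependent_pow (K := F) t) _ hsum
  rintro ⟨j, i⟩
  have hj : ∑ i, g (j, i) • u i = 0 := by
    have h := congrArg Subtype.val (hw0 j)
    simpa only [IntermediateField.smul_def, smul_eq_mul, ZeroMemClass.coe_zero] using h
  exact Fintype.linearIndependent_iff.mp hu (fun i => g (j, i)) hj i

/-- **`t ∉ Frac A₀` from a non-vanishing derivative**: if some derivation of `S` does not kill
`t ^ p`, then `t` is not a fraction of elements of `A₀ ⊆ S`. [folklore] -/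
theorem not_mem_adjoin_of_apply_ne_zero (p : ℕ) [Fact p.Prime] [CharP K p] (A₀ : Subalgebra k K)
    (t : K) (S : Subring K) (hA₀S : A₀.toSubring ≤ S) (htp : t ^ p ∈ S)
    (hδ : ∃ δ : Derivation ℤ S S, δ ⟨t ^ p, htp⟩ ≠ 0) :
    t ∉ IntermediateField.adjoin k (A₀ : Set K) := by
  intro ht
  obtain ⟨y, hy, z, hz, hz0, hyz⟩ := DegreePTransfer.exists_div_of_mem_adjoin A₀ ht
  obtain ⟨δ, hδ⟩ := hδ
  apply hδ
  -- `t ^ p * z ^ p = y ^ p` in `S`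
  have hrel : (⟨t ^ p, htp⟩ : S) * ⟨z, hA₀S hz⟩ ^ p = ⟨y, hA₀S hy⟩ ^ p := by
    apply Subtype.ext
    simp only [Subring.coe_mul, SubmonoidClass.coe_pow]
    rw [hyz, div_pow, div_mul_cancel₀ _ (pow_ne_zero _ hz0)]
  have h := congrArg δ hrel
  rw [δ.leibniz, apply_pow_char_eq_zero p S δ, apply_pow_char_eq_zero p S δ, smul_zero, zero_add,
    smul_eq_mul, mul_eq_zero] at h
  exact h.resolve_left (pow_ne_zero _ fun h0 => hz0 (congrArg Subtype.val h0))

/-- **Constants are `p`-th powers (the content half of `B = S ∩ K^p`).** Crux frame: `k ⊆ K` of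
characteristic `p`, `A₀ ⊆ K` a `k`-subalgebra, `t ∈ K` with `t ^ p ∈ A₀` and `Frac (A₀[t]) = K`;
`S ⊆ K` a subring with `A₀ ⊆ S ⊆ Frac A₀`; `D₁, …, D_r` derivations of `S` killing `t ^ p`, NOT all
derivations of `S` killing `t ^ p` (so `t ∉ Frac A₀`); `B ⊆ S` their joint kernel; a `B`-linearly
independent family in `S` with `p ^ r` members (the `p`-monomials in a dual family, supplied by the
iterated slice decomposition); and the `p`-degree `[K : K^p] = p ^ (r + 1)`. Then every constant is a
`p`-th power in `K`: `B ⊆ K^p`. Proof (degree count inside `K`): `K^p ⊆ L := Frac B`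
(`frobenius_fieldRange_le_closure`); `[K : L] ≥ p · p ^ r` by the `L`-linearly independent family
`t ^ j · v i` (`linearIndependent_of_fractions`, `linearIndependent_pow_mul`, `[K : Frac A₀] = p` from
`DegreePTransfer.finrank_fracField_eq_one_or_eq_prime`); the tower `[K : K^p] = [L : K^p] · [K : L]`
forces `[L : K^p] = 1`. [cite: Matsumura1987, Thm. 26.5] [folklore] -/
theorem exists_pow_eq_of_mem (p : ℕ) [Fact p.Prime] [CharP K p] (A₀ : Subalgebra k K) (t : K)
    (htpA : t ^ p ∈ A₀) (hfr : IsFractionRing (Algebra.adjoin k (insert t (A₀ : Set K))) K)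
    (S : Subring K) (hA₀S : A₀.toSubring ≤ S)
    (hSF : ∀ x ∈ S, ∃ y ∈ A₀, ∃ z ∈ A₀, z ≠ 0 ∧ x = y / z) {r : ℕ}
    (D : Fin r → Derivation ℤ S S) (hDf : ∀ i, D i ⟨t ^ p, hA₀S htpA⟩ = 0)
    (hδ : ∃ δ : Derivation ℤ S S, δ ⟨t ^ p, hA₀S htpA⟩ ≠ 0)
    (B : Subring S) (hB : ∀ c, c ∈ B ↔ ∀ i, D i c = 0)
    {ι : Type} [Fintype ι] (v : ι → S) (hv : LinearIndependent B v)
    (hcard : Fintype.card ι = p ^ r)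
    (hdeg : Module.finrank (frobenius K p).fieldRange K = p ^ (r + 1))
    (x : S) (hx : x ∈ B) : ∃ c : K, c ^ p = x := by
  classical
  have hp : p.Prime := Fact.out
  haveI : CharP k p := (algebraMap k K).charP (algebraMap k K).injective p
  -- ### the fields `E = K^p ≤ L = Frac B ≤ F = Frac A₀ ≤ K`
  set E : Subfield K := (frobenius K p).fieldRange with hE
  have hEL : E ≤ Subfield.closure ((B.map S.subtype : Subring K) : Set K) :=
    frobenius_fieldRange_le_closure p A₀ t hfr S hA₀S (hA₀S htpA) D hDf B hB
  let L : IntermediateField E K :=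
    (Subfield.closure ((B.map S.subtype : Subring K) : Set K)).toIntermediateField fun e => hEL e.2
  have hLmem : ∀ c : K, c ∈ L ↔ c ∈ Subfield.closure ((B.map S.subtype : Subring K) : Set K) :=
    fun c => Iff.rfl
  set F : IntermediateField k K := IntermediateField.adjoin k (A₀ : Set K) with hF
  have hSF' : ∀ c : K, c ∈ S → c ∈ F := fun c hc =>
    DegreePTransfer.mem_adjoin_of_exists_div A₀ (hSF c hc)
  have hBF : ((B.map S.subtype : Subring K) : Set K) ⊆ F := by
    rintro _ ⟨b, -, rfl⟩
    exact hSF' _ b.2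
  have hLF : ∀ c : K, c ∈ L → c ∈ F := fun c hc =>
    (Subfield.closure_le (t := F.toSubfield)).mpr hBF ((hLmem c).mp hc)
  -- ### `[K : F] = p` and `deg_F t = p`
  have htF : t ∉ F := not_mem_adjoin_of_apply_ne_zero p A₀ t S hA₀S (hA₀S htpA) hδ
  have hKF : Module.finrank F K = p := by
    rcases DegreePTransfer.finrank_fracField_eq_one_or_eq_prime hp A₀ t htpA hfr with h1 | hP
    · exfalso
      apply htF
      have htop : t ∈ (⊤ : IntermediateField F K) := IntermediateField.mem_top
      rw [← IntermediateField.bot_eq_top_iff_finrank_eq_one.mpr h1, IntermediateField.mem_bot] at htop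
      obtain ⟨f, hf⟩ := htop
      rw [← hf]
      exact f.2
    · exact hP
  have hint : IsIntegral F t :=
    isAlgebraic_iff_isIntegral.mp ⟨X ^ p - C ⟨t ^ p, IntermediateField.subset_adjoin k _ htpA⟩,
      (monic_X_pow_sub_C _ hp.ne_zero).ne_zero, by simp⟩
  have hnat : (minpoly F t).natDegree = p := by
    rw [← IntermediateField.adjoin.finrank hint, DegreePTransfer.adjoin_fracField_simple_eq_top A₀ t hfr,
      IntermediateField.finrank_top', hKF]
  -- ### finiteness
  have hfinE : Module.Finite E K :=
    Module.finite_of_finrank_pos (by rw [hdeg]; exact pow_pos hp.pos _)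
  haveI : FiniteDimensional E K := hfinE
  -- ### `[K : L] ≥ p ^ (r + 1)` from the independent family `t ^ j · v i`
  have hL : ∀ c : K, c ∈ L → ∃ a ∈ B.map S.subtype, ∃ b ∈ B.map S.subtype, b ≠ 0 ∧ c = a / b :=
    fun c hc => exists_div_eq_of_mem_subfieldClosure (B := B.map S.subtype) ((hLmem c).mp hc)
  have hli := linearIndependent_pow_mul L F hLF t hnat (fun i => (v i : K)) (fun i => hSF' _ (v i).2)
    (linearIndependent_of_fractions L S B hL v hv)
  have hge : p ^ (r + 1) ≤ Module.finrank L K := by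
    have h := hli.fintype_card_le_finrank
    rwa [Fintype.card_prod, Fintype.card_fin, hcard, ← pow_succ'] at h
  -- ### the tower `[K : E] = [L : E] · [K : L]` forces `[L : E] = 1`
  have htower := Module.finrank_mul_finrank E L K
  rw [hdeg] at htower
  have hLpos : 0 < Module.finrank E L := Module.finrank_pos
  have hLE : Module.finrank E L = 1 := by
    have hKL : 0 < Module.finrank L K := lt_of_lt_of_le (pow_pos hp.pos _) hge
    nlinarith
  have hbot : L = ⊥ := IntermediateField.finrank_eq_one_iff.mp hLE
  -- ### conclusion: `x ∈ B ⊆ L = E = K^p`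
  have hxL : (x : K) ∈ L := (hLmem _).mpr (Subfield.subset_closure ⟨x, hx, rfl⟩)
  rw [hbot, IntermediateField.mem_bot] at hxL
  obtain ⟨e, he⟩ := hxL
  obtain ⟨c, hc⟩ := RingHom.mem_fieldRange.mp e.2
  exact ⟨c, by rw [← he, ← frobenius_def, hc]; rfl⟩

/-- **`B = S ∩ K^p`** — the joint kernel of the derivations `D₁, …, D_r` of `S` consists exactly of the
elements of `S` that are `p`-th powers in `K` (the input `hB` of the sandwich model, chain W4.1
sub-stub L4): `mem_of_pow_eq` and `exists_pow_eq_of_mem`. [cite: Matsumura1987, Thm. 26.5]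
[folklore] -/
theorem mem_iff (p : ℕ) [Fact p.Prime] [CharP K p] (A₀ : Subalgebra k K) (t : K)
    (htpA : t ^ p ∈ A₀) (hfr : IsFractionRing (Algebra.adjoin k (insert t (A₀ : Set K))) K)
    (S : Subring K) (hA₀S : A₀.toSubring ≤ S)
    (hSF : ∀ x ∈ S, ∃ y ∈ A₀, ∃ z ∈ A₀, z ≠ 0 ∧ x = y / z) {r : ℕ}
    (D : Fin r → Derivation ℤ S S) (hDf : ∀ i, D i ⟨t ^ p, hA₀S htpA⟩ = 0)
    (hδ : ∃ δ : Derivation ℤ S S, δ ⟨t ^ p, hA₀S htpA⟩ ≠ 0)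
    (B : Subring S) (hB : ∀ c, c ∈ B ↔ ∀ i, D i c = 0)
    {ι : Type} [Fintype ι] (v : ι → S) (hv : LinearIndependent B v)
    (hcard : Fintype.card ι = p ^ r)
    (hdeg : Module.finrank (frobenius K p).fieldRange K = p ^ (r + 1)) (x : S) :
    x ∈ B ↔ ∃ c : K, c ^ p = x :=
  ⟨exists_pow_eq_of_mem p A₀ t htpA hfr S hA₀S hSF D hDf hδ B hB v hv hcard hdeg x,
    fun ⟨c, hc⟩ => mem_of_pow_eq p A₀ t hfr S hA₀S (hA₀S htpA) D hDf B hB x c hc⟩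

end ConstantsPthPowers

end Summit.ResolutionOfSingularities.ResolutionOfSingularities.Theorems.SwitchingDichotomy

end
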